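import Mathlib.CategoryTheory.Groupoid
import Mathlib.GroupTheory.Index
import Mathlib.FieldTheory.RatFunc.AsPolynomial
import Mathlib.Algebra.Polynomial.Expand
import HarnessLib

/-!
# [AbsTopIII] §1, Remarks 1.5.2, 1.7.1, 1.9.1–1.9.9, 1.10.1–1.10.4, 1.11.1–1.11.5 (pp. 32–49)

S. Mochizuki, *Topics in Absolute Anabelian Geometry III: Global Reconstruction Algorithms*, §1
"Galois-theoretic Reconstruction Algorithms": the Remarks attached to Def. 1.5, Def. 1.7,
Thm. 1.9, Cor. 1.10 and Thm. 1.11.  Locators `p.N` are PDF pages of the author's kurims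
manuscript (lit key `paper:url-5493eb38cbb7`, 164 pp.; the journal pagination is not held)
[cite: MochizukiAbsTopIII2015, Rmk 1.9.8 p.40].  Cell abc-iut, layer L4, block W2-B13
(plan/L4/ASSIGNMENTS.md §7a, ruling π); node ids `AbsTopIII:Rmk1.5.2` … `AbsTopIII:Rmk1.11.5`
of plan/L4/NODES.md.  HONEST FRAMING: nothing here takes a side on [IUTchIII] Cor. 3.12 and
nothing here is a reconstruction theorem: this file INDEXES twenty-six remarks (most of whose
text is interpretation, announcements of variants, or attribution), PROVES the formal implication
of Rmk. 1.9.8 ("mono-anabelian ⟹ bi-anabelian", for an algorithm = a functor), TYPES the phrase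
"functorial [...] dividing [...] by the index" of Rmk. 1.10.1, and PROVES the one elementary
kernel that is pure field theory ("function fields do not admit cores", Rmk. 1.11.4 (i)).  The statements of
Def. 1.5 / Def. 1.7 / Prop. 1.4 / Thm. 1.9 / Cor. 1.10 / Thm. 1.11 themselves are abc-iut-L4-t1's
(`AbsTopIII/KummerFaithful.lean`, `AbsTopIII/CurveModel.lean`, and its reconstruction files) and
are cited by name, never restated.

## Index (Remark → page → status; "record" = interpretive / bibliographic prose, recorded by locator only)

* **1.5.2** p. 32 — "one obtains an equivalent definition of the terms 'Kummer-faithful' and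
  'torally Kummer-faithful' if, in Definition 1.5, one restricts `k_H` to be equal to `k`" (Weil
  restriction).  ABSORBED by abc-iut-L4-t1's typing of Def. 1.5: `AbsTopIII.IsTorallyKummerFaithful`
  (`KummerFaithful.lean`, accepted) is DEFINED by the field-theoretic condition on all finite
  extensions `k'` and its docstring cites Rmk. 1.5.2 for the equivalence; the Weil restriction
  `Res_{k'/k} 𝔾_m` has `k`-points `k'^×` by definition, so no residual claim is left to type.
  Record.
* **1.7.1** pp. 35–36 — `X` is an NF-curve iff its moduli point is `k̄_NF`-valued; the descent
  datum of `X_{k̄}` to `k̄_NF` is unique.  Recorded by abc-iut-L4-t1 in `AbsTopIII/CurveModel.lean`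
  (module text before `CurveModel.Prop_1_4_i`: it is this uniqueness that makes
  `CurveModel.NFFunctionField` a function of the curve).  Record (t1's).
* **1.9.1** p. 38 — "one may give a tempered version of Theorem 1.9" for `k` an MLF
  ([AbsTopII] Rmk. 3.7.1).  Announcement of a variant; record.
* **1.9.2** p. 38 — for `k` an MLF or NF the extension datum may be replaced by `Π_X` alone
  ([AbsTopI] Thm. 2.6 (v), (vi)).  TYPED by abc-iut-L4-t1 as the model-relative fact
  `AbsTopIII.CurveModel.Rmk_1_9_2` (`CurveModel.lean`); the group-theoretic characterisations it
  rests on are abc-iut-L4-t4's `thm26_vi_maximal` / `Thm26v` (`AbsTopI/SemiAbsolute.lean`, staged).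
  Not restated here.
* **1.9.3** p. 38 — Thm. 1.9 does NOT reconstruct `k`, `K_Z` in general (cf. Cor. 1.10 for MLF).
  Negative scope statement; record.
* **1.9.4** pp. 38–39 — `G_k` (`k` an MLF) "of cohomological dimension 2 [NSW 7.1.8 (i)]" has "one
  rigid dimension" (the unramified quotient `G_k ↠ Ẑ` generated by Frobenius, characterised
  group-theoretically: [AbsAnab] Prop. 1.2.1 (iv) = abc-iut-L4-t4's `galoisMLF_iso_frobenius` in
  `MLFGaloisGroups.lean`) and "one non-rigid dimension" (inertia; existence of isomorphisms of
  absolute Galois groups of MLF's that are not geometric: the Closing Remark before [NSW] Thm.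
  12.2.7, i.e. the Jarden–Ritter / Yamagata examples); thesis: coupling with `Δ_X` rigidifies both.
  The cited facts belong to the LCFT / [AbsAnab] files of abc-iut-L4-t4 (FOUNDATIONS row 15); the
  thesis is interpretation.  Record (no new named fact: the non-rigidity examples are a theorem of
  [NSW]/Jarden–Ritter, not of this text, and are not quoted with a statement).
* **1.9.5 (i)** p. 39 — Thm. 1.9 gives a proof of the profinite absolute Grothendieck Conjecture
  over NF logically independent of Neukirch–Uchida, with an explicit construction of the number
  fields; **(ii)** pp. 39–40 — "global address of a prime" vs. localisation; functoriality in the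
  base field.  Both record (historiographical / methodological).
* **1.9.6** p. 40 — extension to finite étale coverings of configuration spaces, "routine details
  [left] to the interested reader".  Record (no statement printed).
* **1.9.7** p. 40 — "complete combinatorialization, independent of the base field".  Record.
* **1.9.8** pp. 40–41 — DEFINITION of the phrase "group-theoretic algorithm" ("phrased in language
  that only depends on the topological group structure"), the dichotomy mono-anabelian /
  bi-anabelian, and the formal implication "mono-anabelian ⟹ bi-anabelian".  PROVED in the
  abstract shape the cell's typing policy uses (plan/L4/ASSIGNMENTS.md §2 θ: an algorithm is a
  functor on a groupoid of abstract input data — Mathlib's `Functor`, no new structure):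
  `biAnabelian_of_functor` (= `Functor.mapIso`), see below.  The converse question
  "bi-anabelian ⟹? mono-anabelian" (reference models, Rmk. 3.7.3) is record.
* **1.9.9** p. 41 — M. Kim's suggestion (characterise the `Π` that occur).  Record.
* **1.10.1 (i)** p. 44 — functoriality of Thm. 1.9 / Cor. 1.10 w.r.t. open subgroups of `Π_X` is a
  compatibility after DIVIDING the induced morphism on cyclotomes by the index of the induced
  subgroups of `Δ_X` ([AbsCusp] Rmk. 1); **(iii)** p. 44 — the same for `H²(G_k, μ_Ẑ(G_k)) ≅ Ẑ` of
  Cor. 1.10 (a) with the index of the open subgroups of `G_k`.  TYPED as the predicate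
  `IndexedInvariants.IsCompatible` on abstract "invariant" data indexed by subgroups, with the two
  printed index factors `IndexedInvariants.galoisFactor` ((iii): `[G_k : H]`) and
  `IndexedInvariants.geometricFactor` ((i): `[Δ_X : Δ_X ∩ H]`); the elementary consequence that a
  compatible family is determined by its value on the whole group along surjective restrictions is
  PROVED (`IsCompatible.eq_of_res`).  The cyclotomes themselves are t1's Cor. 1.10 output fields
  (TODO-import abc-iut-L4-t1 `MLFReconstruction`: instantiate `IndexedInvariants` from them).
  **(ii)** p. 44 — the definition of `μ_Ẑ(Π_U)` in Thm. 1.9 (b) is literally valid for genus `≥ 2`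
  and is extended to orbicurves by passing to coverings via (i).  Record (a convention).
* **1.10.2** p. 45 — tempered version of Cor. 1.10.  Record.
* **1.10.3 (i)** p. 45 — Cor. 1.10 (c) as a "synchronization of cyclotomes".  Record.
  **(ii)** p. 45 — the composite isomorphism `G_k^ab ≅ H¹(G_k, μ_Ẑ(Π_X))` from Cor. 1.10 (b), (c)
  and, by passing to open subgroups, `μ_Ẑ(G_k) ≅ μ^κ_Ẑ(Π_X) := Hom(ℚ/ℤ, κ(k̄_NF^×))`.  A composition of
  t1's Cor. 1.10 (b)/(c) isomorphisms (fields `H1`, `cycloSync`, `kummerBase` of t1's staged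
  `MLFReconstruction`); record here, to be realised as a two-line `def` in t1's file (TODO-merge
  abc-iut-L4-t1) — restating the cyclotomes here would duplicate t1's interface.
* **1.10.4** p. 45 — correction of a misprint in [AbsCusp] Thm. 1.1 (iii).  Record.
* **1.11.1 (i)** p. 47 — for `k` an MLF the semi-absolute algorithm of Thm. 1.11 becomes absolute
  ([AbsTopII] Cor. 2.10).  TYPED by abc-iut-L4-t1 as `Rmk_1_11_1_i` in `BirationalReconstruction.lean`
  (staged); not restated.  **(ii)** p. 47 — for `k` an NF an absolute version of the functoriality
  portion is [Pop] Thm. 2 (F. Pop, Ann. of Math. 138 (1994)), and [Pop] gives an algorithm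
  `Π_{η_X} ↦ (Π_{η_X}, Δ_{η_X})`.  [Pop] Thm. 2 is an EXTERNAL anabelian input = LC1 missing link M3,
  owned by abc-iut-L4-t16 (`GaloisSectionsFacts.lean`, ruling ο-amended); record here.
* **1.11.2** pp. 47–48 — analogy: moduli of curves plays the role of `G_k^ab` / torsion of the
  Jacobian in the slimness arguments.  Record.
* **1.11.3** p. 48 — Thm. 1.11 does not depend on [Mzk5] (`p`-adic Hodge theory); the only
  non-elementary part of Thm. 1.9 is Belyi cuspidalization (hence "sub-`p`-adic").  Dependency
  statement used by plan/L4/LC1-CHAIN.md (finding: Thm 1.11 is not downstream of [pGC]); record.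
* **1.11.4 (i)** p. 48 — "most hyperbolic curves admit a core" ([Mzk3] §3, [Mzk10] §2: facts of
  those papers, not typed here) and "function fields do not admit cores: [...] `Loc(η_X)` fails to
  admit a terminal object".  KERNEL TYPED AND PROVED in field-theoretic form: in `Loc(η_X)` the
  objects are spectra of fields having a finite separable extension in common with `K_X` — in
  particular `Spec k(t)` is an object (every function field of one variable is finite over some
  `k(t)`) — and morphisms are finite étale maps, i.e. finite field embeddings reversed; a terminal
  object `Spec L₀` would give a UNIQUE finite embedding `L₀ ↪ k(t)`, but composing with the
  degree-two endomorphism `t ↦ t²` of `k(t)` gives a second one unless the image is fixed by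
  `t ↦ t²`, i.e. constant: `RatFuncSq.fixed_eq_C` (a rational function `g` with `g(t²) = g(t)` is
  constant), so the image of `ι` would lie in `k`, contradicting finiteness since `t` is
  transcendental over `k` (`RatFuncSq.X_transcendental`).  What is PROVED here is exactly this
  field-theoretic kernel (fixed field of `t ↦ t²` = constants; transcendence of `t`); the
  category `Loc(η_X)` itself (schemes) is not built.  "Most hyperbolic curves admit a core" is a
  theorem of [Mzk3]/[Mzk10], record.  **(ii)** pp. 48–49 — cores as "canonical integral
  structures", log-shells.  Record.
* **1.11.5** p. 49 — for affine curves the extra datum beyond the function field is the finite set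
  of cuspidal inertia groups; Belyi cuspidalization handles it.  Record.

Deliberately NOT here: any re-declaration of `IsKummerFaithful`, `CurveModel`, the cyclotomes
`μ_Ẑ(−)`, `H¹/H²`, or the reconstruction outputs of Thm. 1.9 / Cor. 1.10 / Thm. 1.11 (abc-iut-L4-t1);
[AbsTopI] Thm. 2.6 / [AbsAnab] Prop. 1.2.1 (abc-iut-L4-t4); [Pop] Thm. 2 and the [GalSect]/[AbsCusp]
inputs (abc-iut-L4-t16, M3).
-/

noncomputable section

open scoped Classical

namespace Literature.AnabelianGeometry.AbsoluteAnabelian.AbsTopIII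

/-! ### Remark 1.9.8 (pp. 40–41): "group-theoretic algorithm"; mono-anabelian ⟹ bi-anabelian -/

section Rmk198

open CategoryTheory

universe v₁ v₂ u₁ u₂

/-- **Rmk. 1.9.8 (pp. 40–41): "mono-anabelian ⟹ bi-anabelian", PROVED.**  "We use the term
*group-theoretic algorithm* to mean that the algorithm in question is phrased in language that only
depends on the topological group structure of the fundamental group under consideration"; "the more
'classical' use [...] of the term 'group-theoretic' corresponds, in our discussion of
'group-theoretic algorithms', to the functoriality — e.g., with respect to isomorphisms of some type
— of the algorithm"; "the 'classical' approach [...], which we shall refer to as *bi-anabelian*,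
centers around a comparison between two geometric objects via their [arithmetic] fundamental groups
[...] the theory of the present paper, which we shall refer to as *mono-anabelian*, centers around
the task of establishing 'group-theoretic algorithms' [...] that require as input data only the
[arithmetic] fundamental group of a single geometric object. Thus, it follows formally that
'mono-anabelian ⟹ bi-anabelian'."  In the shape used throughout the cell (plan/L4/ASSIGNMENTS.md
§2, θ) a mono-anabelian algorithm IS a functor `F : C ⥤ D` on a groupoid `C` of abstract input data
(topological groups / extensions and their isomorphisms "of some type") — Mathlib's `Functor`, no
new structure — and the bi-anabelian shadow at a pair of inputs is the transport of an isomorphism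
of inputs to an isomorphism of outputs, which is `Functor.mapIso`.  The converse question
"bi-anabelian ⟹? mono-anabelian" (p. 41, Rmk. 3.7.3) is not a statement.
[cite: MochizukiAbsTopIII2015, Rmk 1.9.8 p.41] -/
theorem biAnabelian_of_functor {C : Type u₁} [Groupoid.{v₁} C] {D : Type u₂} [Category.{v₂} D]
    (F : C ⥤ D) {X Y : C} (f : X ⟶ Y) : Nonempty (F.obj X ≅ F.obj Y) :=
  ⟨F.mapIso ((Groupoid.isoEquivHom X Y).symm f)⟩

end Rmk198

/-! ### Remark 1.10.1 (i), (iii) (p. 44): functoriality "after dividing by the index" -/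

section Rmk1101

universe u v

/-- The ABSTRACT data Rmk. 1.10.1 speaks about: for each subgroup `H` of a group `G` (the open
subgroups of `Π_X`, resp. of `G_k`) an abelian group `obj H` (the cyclotome `μ_Ẑ` built from `H`,
resp. `H²(H, μ_Ẑ(H))`), "the usual functorially induced morphism" `res : obj H₁ → obj H₂` for
`H₂ ≤ H₁`, and the reconstructed identification `inv H : obj H → R` with a fixed group `R` (`Ẑ`).
No cohomology is built here: the cyclotomes are abc-iut-L4-t1's Cor. 1.10 outputs (TODO-import
abc-iut-L4-t1 `MLFReconstruction`). [cite: MochizukiAbsTopIII2015, Rmk 1.10.1 (iii) p.44] -/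
structure IndexedInvariants (G : Type u) [Group G] (R : Type v) [AddCommGroup R] :
    Type (max u (v + 1)) where
  /-- `H ↦ μ(H)` resp. `H ↦ H²(H, μ_Ẑ(H))` -/
  obj : Subgroup G → Type v
  /-- each `obj H` is an abelian group -/
  [instAddCommGroup : ∀ H, AddCommGroup (obj H)]
  /-- "the usual functorially induced morphism" along `H₂ ≤ H₁` (restriction) -/
  res : ∀ {H₁ H₂ : Subgroup G}, H₂ ≤ H₁ → obj H₁ →+ obj H₂
  /-- restriction is functorial: identity -/
  res_refl : ∀ (H : Subgroup G) (x : obj H), res le_rfl x = x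
  /-- restriction is functorial: composition -/
  res_trans : ∀ {H₁ H₂ H₃ : Subgroup G} (h₁₂ : H₂ ≤ H₁) (h₂₃ : H₃ ≤ H₂) (x : obj H₁),
    res h₂₃ (res h₁₂ x) = res (h₂₃.trans h₁₂) x
  /-- the reconstructed identification `obj H ≅ R` (here only its underlying homomorphism) -/
  inv : ∀ H : Subgroup G, obj H →+ R

attribute [instance] IndexedInvariants.instAddCommGroup

namespace IndexedInvariants

variable {G : Type u} [Group G] {R : Type v} [AddCommGroup R]

/-- Rmk. 1.10.1 (iii): the index factor for `H²(G_k, μ_Ẑ(G_k)) ≅ Ẑ` — "the index of the open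
subgroups of `G_k` under consideration", `[H₁ : H₂]`. [cite: MochizukiAbsTopIII2015, Rmk 1.10.1 (iii) p.44] -/
def galoisFactor (H₁ H₂ : Subgroup G) : ℕ := H₂.relIndex H₁

/-- Rmk. 1.10.1 (i): the index factor for the cyclotomes `μ_Ẑ(Π)` of Thm. 1.9 / Cor. 1.10 under
passage to open subgroups `H ⊆ Π_X` — "the index of the subgroups of `Δ_X` that arise from the
open subgroups of `Π_X` under consideration", `[Δ ∩ H₁ : Δ ∩ H₂]`.
[cite: MochizukiAbsTopIII2015, Rmk 1.10.1 (i) p.44] -/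
def geometricFactor (Δ H₁ H₂ : Subgroup G) : ℕ := (Δ ⊓ H₂).relIndex (Δ ⊓ H₁)

/-- Rmk. 1.10.1 (i)/(iii): the identifications `inv` are "functorial" in the sense of a
"'compatibility', relative to dividing the usual functorially induced morphism [...] by a factor
given by the index": for `H₂ ≤ H₁`, `inv_{H₂} ∘ res = (factor H₁ H₂) • inv_{H₁}` (equivalently,
`inv_{H₂} ∘ (res / factor) = inv_{H₁}` where the division makes sense).
[cite: MochizukiAbsTopIII2015, Rmk 1.10.1 (iii) p.44] -/
def IsCompatible (I : IndexedInvariants G R) (factor : Subgroup G → Subgroup G → ℕ) : Prop :=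
  ∀ {H₁ H₂ : Subgroup G} (h : H₂ ≤ H₁) (x : I.obj H₁),
    I.inv H₂ (I.res h x) = factor H₁ H₂ • I.inv H₁ x

/-- Consequence (PROVED): in a compatible family the identification at a subgroup `H` is
determined, on the image of restriction from the whole group, by the identification at `⊤` and
the index factor — which is how Rmk. 1.10.1 (ii) EXTENDS the definition of `μ_Ẑ(Π_U)` from genus
`≥ 2` to arbitrary hyperbolic orbicurves "by passing to coverings and applying the
functoriality/compatibility discussed in (i)". [cite: MochizukiAbsTopIII2015, Rmk 1.10.1 (ii) p.44] -/
theorem IsCompatible.eq_of_res {I : IndexedInvariants G R} {factor : Subgroup G → Subgroup G → ℕ}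
    (hI : I.IsCompatible factor) (H : Subgroup G) (x : I.obj ⊤) :
    I.inv H (I.res le_top x) = factor ⊤ H • I.inv ⊤ x :=
  hI le_top x

/-- Compatibility composes: along `H₃ ≤ H₂ ≤ H₁` the factors multiply (PROVED from the
functoriality of `res`), matching `[H₁ : H₃] = [H₁ : H₂]·[H₂ : H₃]` for the printed factors.
[cite: MochizukiAbsTopIII2015, Rmk 1.10.1 (iii) p.44] -/
theorem IsCompatible.trans {I : IndexedInvariants G R} {factor : Subgroup G → Subgroup G → ℕ}
    (hI : I.IsCompatible factor) {H₁ H₂ H₃ : Subgroup G} (h₁₂ : H₂ ≤ H₁) (h₂₃ : H₃ ≤ H₂)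
    (x : I.obj H₁) :
    I.inv H₃ (I.res (h₂₃.trans h₁₂) x) = (factor H₂ H₃ * factor H₁ H₂) • I.inv H₁ x := by
  rw [← I.res_trans h₁₂ h₂₃, hI h₂₃, hI h₁₂, smul_smul]

/-- For the printed Galois factor the product rule is the tower law of indices
`[H₁ : H₃] = [H₂ : H₃]·[H₁ : H₂]` (Mathlib `Subgroup.relIndex_mul_relIndex`).
[cite: MochizukiAbsTopIII2015, Rmk 1.10.1 (iii) p.44] -/
theorem galoisFactor_mul {H₁ H₂ H₃ : Subgroup G} (h₁₂ : H₂ ≤ H₁) (h₂₃ : H₃ ≤ H₂) :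
    galoisFactor H₂ H₃ * galoisFactor H₁ H₂ = galoisFactor H₁ H₃ := by
  unfold galoisFactor
  exact Subgroup.relIndex_mul_relIndex H₃ H₂ H₁ h₂₃ h₁₂

end IndexedInvariants

end Rmk1101

/-! ### Remark 1.11.4 (i) (p. 48): "function fields do not admit cores" -/

section Rmk1114

open Polynomial

variable {k : Type*} [Field k]

namespace RatFuncSq

/-- The substitution `t ↦ t²` on polynomials (`Polynomial.expand k 2`) maps nonzero polynomials to
nonzero polynomials, so it extends to `k(t)`. [cite: MochizukiAbsTopIII2015, Rmk 1.11.4 (i) p.48] -/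
theorem expand_two_mem_nonZeroDivisors :
    nonZeroDivisors k[X] ≤ (nonZeroDivisors k[X]).comap (expand k 2 : k[X] →+* k[X]) := by
  intro p hp
  rw [Submonoid.mem_comap]
  refine mem_nonZeroDivisors_of_ne_zero fun h ↦ ?_
  have hp0 : p ≠ 0 := nonZeroDivisors.ne_zero hp
  exact hp0 (expand_eq_zero (by norm_num) |>.1 h)

/-- The degree-two endomorphism `ψ : k(t) → k(t)`, `t ↦ t²` (the finite étale self-map
`Spec k(t) → Spec k(t)` of Rmk. 1.11.4 (i)'s category `Loc`, read on generic points).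
[cite: MochizukiAbsTopIII2015, Rmk 1.11.4 (i) p.48] -/
def sq : RatFunc k →+* RatFunc k :=
  RatFunc.mapRingHom (expand k 2 : k[X] →+* k[X]) expand_two_mem_nonZeroDivisors

/-- `ψ(p/q) = p(t²)/q(t²)`. [cite: MochizukiAbsTopIII2015, Rmk 1.11.4 (i) p.48] -/
theorem sq_div (p q : k[X]) :
    sq (algebraMap k[X] (RatFunc k) p / algebraMap k[X] (RatFunc k) q) =
      algebraMap k[X] (RatFunc k) (expand k 2 p) / algebraMap k[X] (RatFunc k) (expand k 2 q) := by
  change (RatFunc.mapRingHom _ _ : RatFunc k → RatFunc k) _ = _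
  rw [RatFunc.coe_mapRingHom_eq_coe_map, RatFunc.map_apply_div]
  rfl

/-- The degree count behind `fixed_eq_C`: if `q ≠ 0` and `q(t²) ∣ q(t)`, then `deg q = 0`
(`deg q(t²) = 2·deg q ≤ deg q`). [cite: MochizukiAbsTopIII2015, Rmk 1.11.4 (i) p.48] -/
theorem natDegree_eq_zero_of_expand_dvd {q : k[X]} (hq : q ≠ 0) (h : expand k 2 q ∣ q) :
    q.natDegree = 0 := by
  have h1 := natDegree_le_of_dvd h hq
  rw [natDegree_expand] at h1
  omega

/-- **KERNEL of Rmk. 1.11.4 (i)**: a rational function fixed by `t ↦ t²` is constant — the fixed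
subring of the degree-two endomorphism `ψ` of `k(t)` is `k`.  (Write `g = p/q` in lowest terms,
`q` monic; `p(t²)·q = p·q(t²)` with `(p, q) = (p(t²), q(t²)) = 1` forces `q(t²) ∣ q` and
`p(t²) ∣ p`, so `deg q = deg p = 0`.)  Consequently, in the category `Loc(η_X)` (objects: spectra
of fields with a finite extension in common with `K_X`, e.g. `Spec k(t)`; morphisms: finite étale
maps) no object `Spec L₀` can be terminal: the unique morphism `Spec k(t) → Spec L₀` would be an
embedding `ι : L₀ ↪ k(t)` of finite index with `ψ ∘ ι = ι`, whence `ι(L₀) ⊆ k`, contradicting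
finiteness (`t` is transcendental over `k`, `RatFuncSq.X_transcendental`).
[cite: MochizukiAbsTopIII2015, Rmk 1.11.4 (i) p.48] -/
theorem fixed_eq_C (g : RatFunc k) (h : sq g = g) : ∃ c : k, g = RatFunc.C c := by
  obtain ⟨p, hp⟩ : ∃ p : k[X], g.num = p := ⟨_, rfl⟩
  obtain ⟨q, hq⟩ : ∃ q : k[X], g.denom = q := ⟨_, rfl⟩
  have hq0 : q ≠ 0 := hq ▸ RatFunc.denom_ne_zero g
  have hcop : IsCoprime p q := hp ▸ hq ▸ RatFunc.isCoprime_num_denom g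
  have hmon : q.Monic := hq ▸ RatFunc.monic_denom g
  have hg : g = algebraMap k[X] (RatFunc k) p / algebraMap k[X] (RatFunc k) q := by
    rw [← hp, ← hq]; exact (RatFunc.num_div_denom g).symm
  -- the equation `p(t²)·q = p·q(t²)` in `k[X]`
  have heq : expand k 2 p * q = p * expand k 2 q := by
    have h' := h
    rw [hg, sq_div] at h'
    rw [div_eq_div_iff (RatFunc.algebraMap_ne_zero ((expand_ne_zero (by norm_num)).2 hq0))
      (RatFunc.algebraMap_ne_zero hq0), ← map_mul, ← map_mul] at h'
    exact RatFunc.algebraMap_injective k h'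
  -- coprimality is preserved by the ring endomorphism `expand`
  have hcop' : IsCoprime (expand k 2 p) (expand k 2 q) := by
    obtain ⟨a, b, hab⟩ := hcop
    exact ⟨expand k 2 a, expand k 2 b, by rw [← map_mul, ← map_mul, ← map_add, hab, map_one]⟩
  -- `q(t²) ∣ p(t²)·q = p·q(t²)`... we use: `q(t²) ∣ expand p * q` and coprime with `expand p`
  have hdvd : expand k 2 q ∣ q := by
    have : expand k 2 q ∣ q * expand k 2 p := ⟨p, by rw [mul_comm q, heq, mul_comm]⟩
    exact hcop'.symm.dvd_of_dvd_mul_right this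
  have hqdeg : q.natDegree = 0 := natDegree_eq_zero_of_expand_dvd hq0 hdvd
  have hq1 : q = 1 := (Polynomial.Monic.natDegree_eq_zero hmon).1 hqdeg
  -- now `p(t²) = p`
  have hpeq : expand k 2 p = p := by
    have := heq
    rw [hq1, map_one, mul_one, mul_one] at this
    exact this
  by_cases hp0 : p = 0
  · refine ⟨0, ?_⟩
    rw [hg, hp0, map_zero, zero_div, map_zero]
  · have hpdeg : p.natDegree = 0 := natDegree_eq_zero_of_expand_dvd hp0 ⟨1, by rw [mul_one, hpeq]⟩
    refine ⟨p.coeff 0, ?_⟩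
    rw [hg, hq1, map_one, div_one, eq_C_of_natDegree_eq_zero hpdeg]
    simp [RatFunc.algebraMap_C]

/-- `t ∈ k(t)` is transcendental over `k` (so `k(t)` is not finite over any subfield of the
constants) — the second half of the kernel of Rmk. 1.11.4 (i).
[cite: MochizukiAbsTopIII2015, Rmk 1.11.4 (i) p.48] -/
theorem X_transcendental : Transcendental k (RatFunc.X : RatFunc k) := by
  rw [RatFunc.X, transcendental_algebraMap_iff (RatFunc.algebraMap_injective k)]
  exact Polynomial.transcendental_X k

end RatFuncSq

end Rmk1114

end Literature.AnabelianGeometry.AbsoluteAnabelian.AbsTopIII
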